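import Literature.AlgebraicTopology.SingularHomology.HomotopyAdditionProofs
import HarnessLib

/-!
# The two cube–simplex devices agree: `[g ∘ κ_c] = [g ∘ κ_h]` (dimension `2`)

Topic `Literature/AlgebraicTopology/SingularHomology`. The tree reads a singular simplex
`g : (Δⁿ, ∂Δⁿ) → (X, x₀)` as an element of `πₙ(X, x₀)` through two different maps of pairs
`(Iⁿ, ∂Iⁿ) → (Δⁿ, ∂Δⁿ)` — Spanier's "arbitrary homeomorphism `(Δⁿ, Δ̇ⁿ) ≈ (Iⁿ, İⁿ)`"
(*Algebraic Topology* (1981), Ch. 7 §4 p. 391):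

* the **radial homeomorphism** `κ_h = cubeSimplexHomeo n` of `HurewiczSimplexClass.lean`
  (`simplexClass g = [g ∘ κ_h]`; it is the device behind the relative classes `relSimplexClass` of
  `RelativeSimplexClass.lean` and the relative homotopy addition facts `relHomotopyAddition`,
  `relHomotopyAddition_two`);
* the **collapse** `κ_c = CubeCollapse.collapse` of `CubeSimplexCollapse.lean`
  (`collapseClass g = [g ∘ κ_c]`, `HomotopyAdditionProofs.lean`), faces onto faces, for which the
  homotopy addition theorem `prod_collapseClass_face_zpow_eq_one` is proved.

This file proves that **the two classes coincide**, `collapseClass g hg = simplexClass g hg`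
(`collapseClass_eq_simplexClass`), in every dimension `n` in which the two devices are
*non-antipodal* (`NonAntipodal n`: for no `y ∈ ∂Iⁿ` are the boundary points `κ_h(y)` and `κ_c(y)`
of `∂Δⁿ` diametrically opposite in the ball model `SimplexBall.toBall : Δⁿ ≅ D̄ⁿ`), checks the
non-antipodality in dimension `2` by a direct computation (`nonAntipodal_two`,
`collapseClass_eq_simplexClass_two`), and then in every dimension `N ≥ 2` by an induction along
the partial products of the collapse (`nonAntipodal_of_two_le`,
`collapseClass_eq_simplexClass_of_two_le`). Mechanism (all `[folklore]`): in the ball model `D̄ⁿ`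
(sup norm) `κ_h` is the affine stretch `y ↦ 2y - 1` and `κ_c` becomes `w(y) = toBall (κ_c y)`;
the segment from `2y - 1` to `w(y)` avoids `0` for `y ∈ ∂Iⁿ` exactly when the two unit vectors are
not antipodal, and then `Ψₛ(y) = Mₛ(y) / max (‖Mₛ(y)‖, 1 - ‖2y - 1‖)`, `Mₛ = (1 - s)(2y - 1) + s w`,
is a homotopy of maps of pairs `(Iⁿ, ∂Iⁿ) → (D̄ⁿ, ∂D̄ⁿ)` whose ends agree ON `∂Iⁿ` with the
stretch and with `w`; straight-line homotopies in the convex ball, stationary on `∂Iⁿ`, connect the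
ends to the stretch and to `w` themselves. Composing with `g ∘ toBall⁻¹` gives
`g ∘ κ_h ≃ g ∘ κ_c rel ∂Iⁿ`. This is the comparison "the classes of this tree differ from
Spanier's by a bijection natural in `(X, A, a)` which is a group isomorphism up to a global sign"
announced in `RelativeHomotopyAddition.lean`, settled with sign `+1` in all dimensions `≥ 2`; in
dimension `2` it transports the homotopy addition theorem to `simplexClass` and `relSimplexClass`
(the degree-`2` relative homotopy addition theorem `relHomotopyAddition_two` of
`RelativeHurewiczEquivProofs.lean`, proved in `RelativeHomotopyAdditionTwoProofs.lean`).

## References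

* E. H. Spanier, *Algebraic Topology*, Springer (1981), Ch. 7 §4, p. 391. [Spanier1981]
* A. Hatcher, *Algebraic Topology*, CUP (2002), §4.1, p. 340 (maps of pairs `(Iⁿ, ∂Iⁿ)`).
  [HatcherAT2002]
-/

noncomputable section

open Set Metric Function
open scoped unitInterval Topology Topology.Homotopy

universe u

namespace Literature.AlgebraicTopology.SingularHomology

open CubeCollapse
open Literature.AlgebraicTopology.Homotopy (SimplexBall.toBall SimplexBall.toBall_coe
  SimplexBall.toBall_mem_sphere_iff SimplexBall.chart SimplexBall.rescale SimplexBall.c SimplexBall.body)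

section General

variable {n : ℕ}

/-! ### The collapse in the ball model -/

/-- **`w(y) = toBall (κ_c y) ∈ D̄ⁿ`**: the collapse read in the ball model of the simplex. [folklore] -/
def collapseBall (y : Fin n → I) : Fin n → ℝ := (SimplexBall.toBall n (collapse y) : Fin n → ℝ)

/-- Unfolding of `collapseBall`. [folklore] -/
lemma collapseBall_eq (y : Fin n → I) :
    collapseBall y = SimplexBall.rescale n (SimplexBall.chart n (collapse y)) := rfl

/-- `w` is continuous. [folklore] -/
lemma continuous_collapseBall : Continuous (collapseBall (n := n)) :=
  continuous_subtype_val.comp ((SimplexBall.toBall n).continuous.comp continuous_collapse)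

/-- `w(y)` lies in the closed unit ball. [folklore] -/
lemma norm_collapseBall_le (y : Fin n → I) : ‖collapseBall y‖ ≤ 1 :=
  mem_closedBall_zero_iff.1 (SimplexBall.toBall n (collapse y)).2

/-- `w(∂Iⁿ) ⊆ ∂D̄ⁿ`. [folklore] -/
lemma norm_collapseBall_eq_one {y : Fin n → I} (hy : y ∈ Cube.boundary (Fin n)) : ‖collapseBall y‖ = 1 := by
  have h := (SimplexBall.toBall_mem_sphere_iff n (collapse y)).2
    ((mem_stdBoundary_iff _).1 (collapse_mem_stdBoundary hy))
  rwa [mem_sphere_zero_iff_norm] at h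

/-- `κ_h⁻¹ (κ_c y) = cubeUnstretch (w y)`. [folklore] -/
lemma cubeSimplexHomeo_symm_collapse (y : Fin n → I) :
    (cubeSimplexHomeo n).symm (collapse y) = cubeUnstretch n (collapseBall y) := rfl

variable (n) in
/-- **Non-antipodality of the two devices in dimension `n`**: for no `y ∈ ∂Iⁿ` are the unit
vectors `2y - 1 = toBall (κ_h y)` and `w(y) = toBall (κ_c y)` opposite. [folklore] -/
def NonAntipodal : Prop := ∀ y ∈ Cube.boundary (Fin n), collapseBall y + cubeStretch n y ≠ 0

/-! ### The deformation in the ball model -/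

/-- The segment `Mₛ(y) = (1 - s)(2y - 1) + s w(y)`. [folklore] -/
def seg (s : ℝ) (y : Fin n → I) : Fin n → ℝ := (1 - s) • cubeStretch n y + s • collapseBall y

/-- `Mₛ(y)` lies in the closed unit ball for `s ∈ [0, 1]`. [folklore] -/
lemma norm_seg_le (s : I) (y : Fin n → I) : ‖seg s y‖ ≤ 1 := by
  have h0 : 0 ≤ 1 - (s : ℝ) := sub_nonneg.2 s.2.2
  calc ‖seg s y‖ ≤ ‖(1 - (s : ℝ)) • cubeStretch n y‖ + ‖(s : ℝ) • collapseBall y‖ := norm_add_le _ _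
    _ = (1 - (s : ℝ)) * ‖cubeStretch n y‖ + (s : ℝ) * ‖collapseBall y‖ := by
        rw [norm_smul, norm_smul, Real.norm_of_nonneg h0, Real.norm_of_nonneg s.2.1]
    _ ≤ (1 - (s : ℝ)) * 1 + (s : ℝ) * 1 := by
        gcongr
        · exact norm_cubeStretch_le y
        · exact s.2.1
        · exact norm_collapseBall_le y
    _ = 1 := by ring

/-- Under non-antipodality the segment over a boundary point avoids the centre. [folklore] -/
lemma seg_ne_zero (hNA : NonAntipodal n) {y : Fin n → I} (hy : y ∈ Cube.boundary (Fin n)) (s : I) :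
    seg s y ≠ 0 := by
  intro h
  have hv : ‖cubeStretch n y‖ = 1 := (norm_cubeStretch_eq_one_iff y).2 hy
  have hw : ‖collapseBall y‖ = 1 := norm_collapseBall_eq_one hy
  have h1 : (1 - (s : ℝ)) • cubeStretch n y = -((s : ℝ) • collapseBall y) := eq_neg_of_add_eq_zero_left h
  have h2 : 1 - (s : ℝ) = s := by
    have := congrArg norm h1
    rwa [norm_neg, norm_smul, norm_smul, hv, hw, mul_one, mul_one,
      Real.norm_of_nonneg (sub_nonneg.2 s.2.2), Real.norm_of_nonneg s.2.1] at this
  have hs : (s : ℝ) ≠ 0 := by intro h0; rw [h0] at h2; norm_num at h2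
  rw [h2] at h1
  have h3 : cubeStretch n y = -collapseBall y := by
    have := congrArg (fun v => (s : ℝ)⁻¹ • v) h1
    simpa only [smul_neg, smul_smul, inv_mul_cancel₀ hs, one_smul] using this
  exact hNA y hy (by rw [h3, add_neg_cancel])

/-- The denominator `max (‖Mₛ(y)‖, 1 - ‖2y - 1‖)`. [folklore] -/
def den (s : ℝ) (y : Fin n → I) : ℝ := max ‖seg s y‖ (1 - ‖cubeStretch n y‖)

/-- The denominator is positive (non-antipodality on `∂Iⁿ`, `‖2y - 1‖ < 1` inside). [folklore] -/
lemma den_pos (hNA : NonAntipodal n) (s : I) (y : Fin n → I) : 0 < den s y := by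
  by_cases hy : y ∈ Cube.boundary (Fin n)
  · exact lt_max_of_lt_left (norm_pos_iff.2 (seg_ne_zero hNA hy s))
  · have h : ‖cubeStretch n y‖ < 1 :=
      lt_of_le_of_ne (norm_cubeStretch_le y) fun h => hy ((norm_cubeStretch_eq_one_iff y).1 h)
    exact lt_max_of_lt_right (sub_pos.2 h)

/-- On the boundary the denominator is `‖Mₛ(y)‖`. [folklore] -/
lemma den_of_mem_boundary {y : Fin n → I} (hy : y ∈ Cube.boundary (Fin n)) (s : ℝ) : den s y = ‖seg s y‖ := by
  rw [den, (norm_cubeStretch_eq_one_iff y).2 hy, sub_self]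
  exact max_eq_left (norm_nonneg _)

/-- **The deformation `Ψₛ(y) = Mₛ(y) / max (‖Mₛ(y)‖, 1 - ‖2y - 1‖)` in the ball model.** [folklore] -/
def psiBall (s : I) (y : Fin n → I) : Fin n → ℝ := (den s y)⁻¹ • seg s y

/-- `Ψₛ(y)` lies in the closed unit ball. [folklore] -/
lemma norm_psiBall_le (hNA : NonAntipodal n) (s : I) (y : Fin n → I) : ‖psiBall s y‖ ≤ 1 := by
  rw [psiBall, norm_smul, norm_inv, Real.norm_of_nonneg (den_pos hNA s y).le,
    inv_mul_le_iff₀ (den_pos hNA s y), mul_one]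
  exact le_max_left _ _

/-- `Ψₛ(∂Iⁿ) ⊆ ∂D̄ⁿ`. [folklore] -/
lemma norm_psiBall_of_mem_boundary (hNA : NonAntipodal n) {y : Fin n → I} (hy : y ∈ Cube.boundary (Fin n))
    (s : I) : ‖psiBall s y‖ = 1 := by
  rw [psiBall, norm_smul, norm_inv, den_of_mem_boundary hy, norm_norm,
    inv_mul_cancel₀ (norm_ne_zero_iff.2 (seg_ne_zero hNA hy s))]

/-- `Ψ₀ = 2y - 1` on `∂Iⁿ`. [folklore] -/
lemma psiBall_zero_of_mem_boundary {y : Fin n → I} (hy : y ∈ Cube.boundary (Fin n)) :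
    psiBall 0 y = cubeStretch n y := by
  have hseg : seg ((0 : I) : ℝ) y = cubeStretch n y := by
    simp [seg]
  rw [psiBall, den_of_mem_boundary hy, hseg, (norm_cubeStretch_eq_one_iff y).2 hy, inv_one, one_smul]

/-- `Ψ₁ = w` on `∂Iⁿ`. [folklore] -/
lemma psiBall_one_of_mem_boundary {y : Fin n → I} (hy : y ∈ Cube.boundary (Fin n)) :
    psiBall 1 y = collapseBall y := by
  have hseg : seg ((1 : I) : ℝ) y = collapseBall y := by
    simp [seg]
  rw [psiBall, den_of_mem_boundary hy, hseg, norm_collapseBall_eq_one hy, inv_one, one_smul]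

/-- `(s, y) ↦ Mₛ(y)` is continuous. [folklore] -/
lemma continuous_seg : Continuous fun p : I × (Fin n → I) => seg p.1 p.2 := by
  unfold seg
  have h1 : Continuous fun p : I × (Fin n → I) => cubeStretch n p.2 := (continuous_cubeStretch n).comp continuous_snd
  have h2 : Continuous fun p : I × (Fin n → I) => collapseBall p.2 := continuous_collapseBall.comp continuous_snd
  have hs : Continuous fun p : I × (Fin n → I) => ((p.1 : I) : ℝ) := continuous_subtype_val.comp continuous_fst
  exact ((continuous_const.sub hs).smul h1).add (hs.smul h2)

/-- `(s, y) ↦ Ψₛ(y)` is continuous. [folklore] -/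
lemma continuous_psiBall (hNA : NonAntipodal n) : Continuous fun p : I × (Fin n → I) => psiBall p.1 p.2 := by
  have hden : Continuous fun p : I × (Fin n → I) => den p.1 p.2 := by
    unfold den
    exact continuous_seg.norm.max (continuous_const.sub ((continuous_cubeStretch n).comp continuous_snd).norm)
  exact (hden.inv₀ fun p => (den_pos hNA p.1 p.2).ne').smul continuous_seg

/-- `y ↦ Ψₛ(y)` is continuous for fixed `s`. [folklore] -/
lemma continuous_psiBall_right (hNA : NonAntipodal n) (s : I) : Continuous fun y : Fin n → I => psiBall s y :=
  show Continuous ((fun p : I × (Fin n → I) => psiBall p.1 p.2) ∘ fun y => (s, y)) from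
    (continuous_psiBall hNA).comp (Continuous.prodMk_right s)

/-- The straight line from the stretch to `Ψ₀`: `(s, y) ↦ (1 - s)(2y - 1) + s Ψ₀(y)`. [folklore] -/
def lineIn (p : I × (Fin n → I)) : Fin n → ℝ := (1 - (p.1 : ℝ)) • cubeStretch n p.2 + (p.1 : ℝ) • psiBall 0 p.2

/-- The straight line from `Ψ₁` to `w`: `(s, y) ↦ (1 - s) Ψ₁(y) + s w(y)`. [folklore] -/
def lineOut (p : I × (Fin n → I)) : Fin n → ℝ := (1 - (p.1 : ℝ)) • psiBall 1 p.2 + (p.1 : ℝ) • collapseBall p.2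

/-- `lineIn` is continuous. [folklore] -/
lemma continuous_lineIn (hNA : NonAntipodal n) : Continuous (lineIn (n := n)) := by
  have hs : Continuous fun p : I × (Fin n → I) => ((p.1 : I) : ℝ) := continuous_subtype_val.comp continuous_fst
  have h1 : Continuous fun p : I × (Fin n → I) => cubeStretch n p.2 := (continuous_cubeStretch n).comp continuous_snd
  have h2 : Continuous fun p : I × (Fin n → I) => psiBall 0 p.2 := (continuous_psiBall_right hNA 0).comp continuous_snd
  show Continuous fun p : I × (Fin n → I) => (1 - (p.1 : ℝ)) • cubeStretch n p.2 + (p.1 : ℝ) • psiBall 0 p.2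
  exact ((continuous_const.sub hs).smul h1).add (hs.smul h2)

/-- `lineOut` is continuous. [folklore] -/
lemma continuous_lineOut (hNA : NonAntipodal n) : Continuous (lineOut (n := n)) := by
  have hs : Continuous fun p : I × (Fin n → I) => ((p.1 : I) : ℝ) := continuous_subtype_val.comp continuous_fst
  have h1 : Continuous fun p : I × (Fin n → I) => psiBall 1 p.2 := (continuous_psiBall_right hNA 1).comp continuous_snd
  have h2 : Continuous fun p : I × (Fin n → I) => collapseBall p.2 := continuous_collapseBall.comp continuous_snd
  show Continuous fun p : I × (Fin n → I) => (1 - (p.1 : ℝ)) • psiBall 1 p.2 + (p.1 : ℝ) • collapseBall p.2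
  exact ((continuous_const.sub hs).smul h1).add (hs.smul h2)

/-! ### The homotopy `g ∘ κ_h ≃ g ∘ κ_c rel ∂Iⁿ` -/

variable {X : Type u} [TopologicalSpace X] {x₀ : X}

/-- `g ∘ κ_h ∘ cubeUnstretch : ℝⁿ → X` (the simplex read in the ball model, extended by the
clamp `cubeUnstretch`). [folklore] -/
def ballMap (g : C(StdSimplex n, X)) : C(Fin n → ℝ, X) :=
  g.comp ((cubeToSimplex n).comp ⟨cubeUnstretch n, continuous_cubeUnstretch n⟩)

/-- `ballMap` pointwise. [folklore] -/
lemma ballMap_apply (g : C(StdSimplex n, X)) (v : Fin n → ℝ) :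
    ballMap g v = g (cubeSimplexHomeo n (cubeUnstretch n v)) := rfl

/-- `ballMap g` is `x₀` on the unit sphere when `g(∂Δⁿ) = {x₀}`. [folklore] -/
lemma ballMap_of_norm_eq_one {g : C(StdSimplex n, X)} (hg : ∀ t ∈ stdBoundary n, g t = x₀)
    {v : Fin n → ℝ} (hv : ‖v‖ = 1) : ballMap g v = x₀ := by
  rw [ballMap_apply]
  apply hg
  rw [cubeSimplexHomeo_mem_stdBoundary_iff, ← norm_cubeStretch_eq_one_iff,
    cubeStretch_cubeUnstretch (mem_closedBall_zero_iff.2 hv.le), hv]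

/-- `ballMap g (2y - 1) = g (κ_h y)`. [folklore] -/
lemma ballMap_cubeStretch (g : C(StdSimplex n, X)) (y : Fin n → I) :
    ballMap g (cubeStretch n y) = g (cubeSimplexHomeo n y) := by
  rw [ballMap_apply, cubeUnstretch_cubeStretch]

/-- `ballMap g (w y) = g (κ_c y)`. [folklore] -/
lemma ballMap_collapseBall (g : C(StdSimplex n, X)) (y : Fin n → I) :
    ballMap g (collapseBall y) = g (collapse y) := by
  rw [ballMap_apply, ← cubeSimplexHomeo_symm_collapse, Homeomorph.apply_symm_apply]

/-- The loop `y ↦ ballMap g (Ψₛ y)` at the base point, `s` fixed. [folklore] -/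
def psiLoop (hNA : NonAntipodal n) (g : C(StdSimplex n, X)) (hg : ∀ t ∈ stdBoundary n, g t = x₀) (s : I) :
    Ω^ (Fin n) X x₀ :=
  ⟨(ballMap g).comp ⟨fun y => psiBall s y, continuous_psiBall_right hNA s⟩, fun y hy => by
    change ballMap g (psiBall s y) = x₀
    exact ballMap_of_norm_eq_one hg (norm_psiBall_of_mem_boundary hNA hy s)⟩

/-- `psiLoop` pointwise. [folklore] -/
lemma psiLoop_apply (hNA : NonAntipodal n) (g : C(StdSimplex n, X))
    (hg : ∀ t ∈ stdBoundary n, g t = x₀) (s : I) (y : Fin n → I) :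
    psiLoop hNA g hg s y = ballMap g (psiBall s y) := rfl

/-- **Step 1**: `g ∘ κ_h ≃ ballMap g ∘ Ψ₀ rel ∂Iⁿ` (straight line in the ball; on `∂Iⁿ` both ends are
`2y - 1`). [folklore] -/
def homotopyStretchPsi (hNA : NonAntipodal n) (g : C(StdSimplex n, X)) (hg : ∀ t ∈ stdBoundary n, g t = x₀) :
    (simplexLoop g hg : C(Fin n → I, X)).HomotopyRel (psiLoop hNA g hg 0) (Cube.boundary (Fin n)) where
  toFun p := ballMap g (lineIn p)
  continuous_toFun := (ballMap g).continuous.comp (continuous_lineIn hNA)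
  map_zero_left y := by
    change ballMap g (lineIn (0, y)) = g (cubeSimplexHomeo n y)
    simp only [lineIn, Icc.coe_zero, sub_zero, one_smul, zero_smul, add_zero, ballMap_cubeStretch]
  map_one_left y := by
    change ballMap g (lineIn (1, y)) = ballMap g (psiBall 0 y)
    simp only [lineIn, Icc.coe_one, sub_self, zero_smul, one_smul, zero_add]
  prop' s y hy := by
    change ballMap g (lineIn (s, y)) = g (cubeSimplexHomeo n y)
    simp only [lineIn]
    rw [psiBall_zero_of_mem_boundary hy, ← add_smul, sub_add_cancel, one_smul, ballMap_cubeStretch]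

/-- **Step 2**: `ballMap g ∘ Ψ₀ ≃ ballMap g ∘ Ψ₁ rel ∂Iⁿ` (the deformation keeps `∂Iⁿ` on the sphere,
where `ballMap g = x₀`). [folklore] -/
def homotopyPsi (hNA : NonAntipodal n) (g : C(StdSimplex n, X)) (hg : ∀ t ∈ stdBoundary n, g t = x₀) :
    (psiLoop hNA g hg 0 : C(Fin n → I, X)).HomotopyRel (psiLoop hNA g hg 1) (Cube.boundary (Fin n)) where
  toFun p := ballMap g (psiBall p.1 p.2)
  continuous_toFun := (ballMap g).continuous.comp (continuous_psiBall hNA)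
  map_zero_left _ := rfl
  map_one_left _ := rfl
  prop' s y hy := by
    change ballMap g (psiBall s y) = ballMap g (psiBall 0 y)
    rw [ballMap_of_norm_eq_one hg (norm_psiBall_of_mem_boundary hNA hy s),
      ballMap_of_norm_eq_one hg (norm_psiBall_of_mem_boundary hNA hy 0)]

/-- **Step 3**: `ballMap g ∘ Ψ₁ ≃ g ∘ κ_c rel ∂Iⁿ` (straight line in the ball; on `∂Iⁿ` both ends
are `w(y)`). [folklore] -/
def homotopyPsiCollapse (hNA : NonAntipodal n) (g : C(StdSimplex n, X)) (hg : ∀ t ∈ stdBoundary n, g t = x₀) :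
    (psiLoop hNA g hg 1 : C(Fin n → I, X)).HomotopyRel (collapseLoop g hg) (Cube.boundary (Fin n)) where
  toFun p := ballMap g (lineOut p)
  continuous_toFun := (ballMap g).continuous.comp (continuous_lineOut hNA)
  map_zero_left y := by
    change ballMap g (lineOut (0, y)) = ballMap g (psiBall 1 y)
    simp only [lineOut, Icc.coe_zero, sub_zero, one_smul, zero_smul, add_zero]
  map_one_left y := by
    change ballMap g (lineOut (1, y)) = g (collapse y)
    simp only [lineOut, Icc.coe_one, sub_self, zero_smul, one_smul, zero_add, ballMap_collapseBall]
  prop' s y hy := by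
    change ballMap g (lineOut (s, y)) = ballMap g (psiBall 1 y)
    simp only [lineOut]
    rw [psiBall_one_of_mem_boundary hy, ← add_smul, sub_add_cancel, one_smul]

/-- **The two devices agree** wherever they are non-antipodal: `[g ∘ κ_c] = [g ∘ κ_h]` in
`πₙ(X, x₀)` for every `g : (Δⁿ, ∂Δⁿ) → (X, x₀)`. [folklore] -/
theorem collapseClass_eq_simplexClass (hNA : NonAntipodal n) (g : C(StdSimplex n, X))
    (hg : ∀ t ∈ stdBoundary n, g t = x₀) : collapseClass g hg = simplexClass g hg := by
  symm
  change (⟦simplexLoop g hg⟧ : π_ n X x₀) = ⟦collapseLoop g hg⟧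
  refine Quotient.sound ?_
  change (simplexLoop g hg : C(Fin n → I, X)).HomotopicRel (collapseLoop g hg) (Cube.boundary (Fin n))
  exact ContinuousMap.HomotopicRel.trans ⟨homotopyStretchPsi hNA g hg⟩
    (ContinuousMap.HomotopicRel.trans ⟨homotopyPsi hNA g hg⟩ ⟨homotopyPsiCollapse hNA g hg⟩)

end General

/-! ### Dimension `2`: the devices are non-antipodal -/

/-- The coordinates of the collapse `κ₂(y) = (1 - y₀, y₀(1 - y₁), y₀ y₁)`. [folklore] -/
lemma collapse_two_apply_one (y : Fin 2 → I) :
    (collapse y : Fin 3 → ℝ) 1 = (y 0 : ℝ) - (y 0 : ℝ) * (y 1 : ℝ) := by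
  rw [collapse_apply]
  change pp y 1 - pp y (1 + 1) = _
  rw [pp_succ y (show 1 < 2 by norm_num), pp_succ y (show 0 < 2 by norm_num), pp_zero,
    tval_of_lt y (show 0 < 2 by norm_num), tval_of_lt y (show 1 < 2 by norm_num)]
  simp

/-- The last coordinate of `κ₂`. [folklore] -/
lemma collapse_two_apply_two (y : Fin 2 → I) :
    (collapse y : Fin 3 → ℝ) 2 = (y 0 : ℝ) * (y 1 : ℝ) := by
  rw [collapse_apply]
  change pp y 2 - pp y (2 + 1) = _
  rw [pp_of_lt y (show 2 < 2 + 1 by norm_num), sub_zero, pp_succ y (show 1 < 2 by norm_num),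
    pp_succ y (show 0 < 2 by norm_num), pp_zero, tval_of_lt y (show 0 < 2 by norm_num),
    tval_of_lt y (show 1 < 2 by norm_num)]
  simp

/-- **The algebraic core of non-antipodality in dimension `2`**: the centred chart of `κ₂(y)` is
never a negative multiple of `2y - 1` for `y ∈ ∂I²` (four edge cases, each a sign or discriminant
contradiction). [folklore] -/
lemma chart_collapse_add_smul_ne_zero {y : Fin 2 → I} (hy : y ∈ Cube.boundary (Fin 2)) {lam : ℝ}
    (hlam : 0 < lam) : SimplexBall.chart 2 (collapse y) + lam • cubeStretch 2 y ≠ 0 := by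
  intro h
  have h0 := congr_fun h 0
  have h1 := congr_fun h 1
  simp only [Pi.add_apply, Pi.smul_apply, smul_eq_mul, Pi.zero_apply, SimplexBall.chart, cubeStretch,
    SimplexBall.c] at h0 h1
  rw [show (0 : Fin 2).succ = 1 from rfl, collapse_two_apply_one] at h0
  rw [show (1 : Fin 2).succ = 2 from rfl, collapse_two_apply_two] at h1
  have hy0 := (y 0).2
  have hy1 := (y 1).2
  norm_num at h0 h1
  obtain ⟨i, hi | hi⟩ := hy
  · fin_cases i
    · have e : (y 0 : ℝ) = 0 := by exact_mod_cast congrArg Subtype.val hi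
      rw [e] at h0; nlinarith
    · have e : (y 1 : ℝ) = 0 := by exact_mod_cast congrArg Subtype.val hi
      rw [e] at h1; nlinarith
  · fin_cases i
    · have e : (y 0 : ℝ) = 1 := by exact_mod_cast congrArg Subtype.val hi
      rw [e] at h0 h1
      nlinarith [sq_nonneg ((y 1 : ℝ) - 1 / 3)]
    · have e : (y 1 : ℝ) = 1 := by exact_mod_cast congrArg Subtype.val hi
      rw [e] at h0 h1
      nlinarith [sq_nonneg ((y 0 : ℝ) - 5 / 12)]

/-- **The two devices are non-antipodal in dimension `2`.** [folklore] -/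
theorem nonAntipodal_two : NonAntipodal 2 := by
  intro y hy h
  -- `w(y) = μ • chart (κ_c y)` with `μ = gauge body / gauge ball ≥ 0`
  set x := SimplexBall.chart 2 (collapse y) with hx
  set μ : ℝ := gauge (SimplexBall.body 2) x / gauge (closedBall (0 : Fin 2 → ℝ) 1) x with hμ
  have hw : collapseBall y = μ • x := rfl
  have hμ0 : 0 ≤ μ := div_nonneg (gauge_nonneg _) (gauge_nonneg _)
  have hv : ‖cubeStretch 2 y‖ = 1 := (norm_cubeStretch_eq_one_iff y).2 hy
  have hμne : μ ≠ 0 := by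
    intro h0
    rw [hw, h0, zero_smul, zero_add] at h
    rw [h, norm_zero] at hv
    exact zero_ne_one hv
  have hμpos : 0 < μ := lt_of_le_of_ne hμ0 (Ne.symm hμne)
  -- `μ • x + v = 0` gives `x + μ⁻¹ • v = 0`
  refine chart_collapse_add_smul_ne_zero hy (inv_pos.2 hμpos) ?_
  have := congrArg (fun v => μ⁻¹ • v) h
  simpa only [hw, smul_add, smul_smul, inv_mul_cancel₀ hμne, one_smul, smul_zero] using this

/-- **`[g ∘ κ_c] = [g ∘ κ_h]` in `π₂(X, x₀)`** for every singular `2`-simplex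
`g : (Δ², ∂Δ²) → (X, x₀)`: the collapse device of `HomotopyAdditionProofs.lean` and the radial
device of `HurewiczSimplexClass.lean` define the same class in dimension `2`. [folklore] -/
theorem collapseClass_eq_simplexClass_two {X : Type u} [TopologicalSpace X] {x₀ : X}
    (g : C(StdSimplex 2, X)) (hg : ∀ t ∈ stdBoundary 2, g t = x₀) :
    collapseClass g hg = simplexClass g hg :=
  collapseClass_eq_simplexClass nonAntipodal_two g hg

/-! ### All dimensions: the devices are never antipodal

The equations `κ_c(y)ᵢ₊₁ - c = -λ (2yᵢ - 1)` (`0 ≤ i < N`, `λ > 0`, `c = 1/(N+1)`) for a boundary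
point `y ∈ ∂Iᴺ` are contradictory: a vanishing coordinate `y_l = 0` gives `λ = -c`; a coordinate
`y_l = 1` forces `λ ≤ c` and then `y_{l-1} = 1`, down to `y₀ = 1`; and from `y₀ = 1` the partial
products `Pⱼ = y₀ ⋯ yⱼ₋₁` satisfy `Pⱼ₊₁ ≥ 1 - j c`, `yⱼ > 1/2` inductively (each step loses less than
`c`), whence `P_N ≥ 2c`, while the last equation gives `P_N < c`. -/

section AllDims

variable {N : ℕ}

/-- The antipodality equations in coordinates: `P_{i+1} - P_{i+2} - c + λ(2yᵢ - 1) = 0`. [folklore] -/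
lemma antipodal_eq {y : Fin N → I} {lam : ℝ}
    (h : SimplexBall.chart N (collapse y) + lam • cubeStretch N y = 0) {i : ℕ} (hi : i < N) :
    pp y (i + 1) - pp y (i + 1 + 1) - SimplexBall.c N + lam * (2 * tval y i - 1) = 0 := by
  have h' := congr_fun h ⟨i, hi⟩
  simp only [Pi.add_apply, Pi.smul_apply, smul_eq_mul, Pi.zero_apply, SimplexBall.chart, cubeStretch,
    collapse_apply, Fin.val_succ] at h'
  rw [tval_of_lt y hi]
  linarith

/-- **The algebraic core of non-antipodality in every dimension `N ≥ 2`**: the centred chart of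
`κ_c(y)` is never a negative multiple of `2y - 1` for `y ∈ ∂Iᴺ`. [folklore] -/
theorem chart_collapse_add_smul_ne_zero_of_two_le (hN : 2 ≤ N) {y : Fin N → I}
    (hy : y ∈ Cube.boundary (Fin N)) {lam : ℝ} (hlam : 0 < lam) :
    SimplexBall.chart N (collapse y) + lam • cubeStretch N y ≠ 0 := by
  intro h
  have hc1 : ((N : ℝ) + 1) * SimplexBall.c N = 1 := by
    rw [SimplexBall.c, mul_one_div_cancel]; positivity
  have hcpos : 0 < SimplexBall.c N := Homotopy.SimplexBall.c_pos N
  have E : ∀ i, i < N → pp y (i + 1) - pp y (i + 1 + 1) - SimplexBall.c N + lam * (2 * tval y i - 1) = 0 :=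
    fun i hi => antipodal_eq h hi
  -- (a) no coordinate vanishes
  have hpos : ∀ i, i < N → 0 < tval y i := by
    intro i hi
    rcases (tval_nonneg y i).lt_or_eq with hlt | heq
    · exact hlt
    · exfalso
      have h1 : pp y (i + 1) = 0 := by rw [pp_succ y hi, ← heq, mul_zero]
      have h2 : pp y (i + 1 + 1) = 0 := pp_eq_zero_of_le y h1 (Nat.le_succ _)
      have h3 := E i hi
      rw [h1, h2, ← heq] at h3
      linarith
  -- (b) a coordinate equal to `1` propagates downwards
  have cascade : ∀ m, m + 1 < N → tval y (m + 1) = 1 → tval y m = 1 := by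
    intro m hm h1
    have El := E (m + 1) hm
    have Em := E m (by omega)
    have hk : pp y (m + 1 + 1) = pp y (m + 1) := by rw [pp_succ y hm, h1, mul_one]
    have hmono : pp y (m + 1 + 1 + 1) ≤ pp y (m + 1 + 1) := pp_succ_le y _
    have hym : tval y m ≤ 1 := tval_le_one y m
    rw [h1] at El
    -- `Em`: `λ (2yₘ - 1) = c`; `El`: `λ = c - (P_{m+2} - P_{m+3}) ≤ c`
    nlinarith
  obtain ⟨l, hl⟩ := hy
  have hl1 : tval y l = 1 := by
    rcases hl with h0 | h1
    · exact absurd (show tval y l = 0 by rw [tval_of_lt y l.2, h0]; rfl) (hpos l l.2).ne'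
    · rw [tval_of_lt y l.2, h1]; rfl
  have hy0 : tval y 0 = 1 := by
    have key : ∀ k, k ≤ (l : ℕ) → tval y ((l : ℕ) - k) = 1 := by
      intro k hk
      induction k with
      | zero => simpa using hl1
      | succ k ih =>
        refine cascade _ (by omega) ?_
        rw [show (l : ℕ) - (k + 1) + 1 = (l : ℕ) - k by omega]
        exact ih (by omega)
    simpa using key l le_rfl
  -- (c) from `y₀ = 1`: `P_{j+1} ≥ 1 - j c` and `yⱼ > 1/2` for all `j < N`
  have up : ∀ j, j < N → 1 - (j : ℝ) * SimplexBall.c N ≤ pp y (j + 1) ∧ 1 / 2 < tval y j := by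
    intro j hj
    induction j with
    | zero =>
      refine ⟨?_, by rw [hy0]; norm_num⟩
      rw [pp_succ y hj, pp_zero, hy0]; norm_num
    | succ j ih =>
      obtain ⟨hP, hyj⟩ := ih (by omega)
      have Ej := E j (by omega)
      have hPs : pp y (j + 1 + 1) = pp y (j + 1) * tval y (j + 1) := pp_succ y hj
      have ht1 : tval y (j + 1) ≤ 1 := tval_le_one y _
      have hjle : (j : ℝ) + 3 ≤ (N : ℝ) + 1 := by
        have : j + 2 ≤ N := by omega
        exact_mod_cast (by omega : j + 3 ≤ N + 1)
      -- the step loses less than `c`: `P_{j+1} - P_{j+2} = c - λ(2yⱼ - 1) < c`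
      have hlt : pp y (j + 1) - pp y (j + 1 + 1) < SimplexBall.c N := by nlinarith
      refine ⟨by push_cast; linarith, ?_⟩
      -- `P_{j+1} (1 - y_{j+1}) < c` with `P_{j+1} ≥ 1 - j c ≥ 3 c`
      have h3c : 3 * SimplexBall.c N ≤ pp y (j + 1) := by nlinarith
      nlinarith
  -- the last equation: `P_N = c - λ(2y_{N-1} - 1) < c`, against `P_N ≥ 2c`
  obtain ⟨n, rfl⟩ : ∃ n, N = n + 1 := ⟨N - 1, by omega⟩
  obtain ⟨hP, hyn⟩ := up n (Nat.lt_succ_self n)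
  have En := E n (Nat.lt_succ_self n)
  rw [pp_of_lt y (by omega : n + 1 < n + 1 + 1)] at En
  have hcast : ((n + 1 : ℕ) : ℝ) = (n : ℝ) + 1 := by push_cast; ring
  rw [hcast] at hc1
  nlinarith

/-- **The two devices are non-antipodal in every dimension `N ≥ 2`.** [folklore] -/
theorem nonAntipodal_of_two_le (hN : 2 ≤ N) : NonAntipodal N := by
  intro y hy h
  set x := SimplexBall.chart N (collapse y) with hx
  set μ : ℝ := gauge (SimplexBall.body N) x / gauge (closedBall (0 : Fin N → ℝ) 1) x with hμ
  have hw : collapseBall y = μ • x := rfl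
  have hμ0 : 0 ≤ μ := div_nonneg (gauge_nonneg _) (gauge_nonneg _)
  have hv : ‖cubeStretch N y‖ = 1 := (norm_cubeStretch_eq_one_iff y).2 hy
  have hμne : μ ≠ 0 := by
    intro h0
    rw [hw, h0, zero_smul, zero_add] at h
    rw [h, norm_zero] at hv
    exact zero_ne_one hv
  have hμpos : 0 < μ := lt_of_le_of_ne hμ0 (Ne.symm hμne)
  refine chart_collapse_add_smul_ne_zero_of_two_le hN hy (inv_pos.2 hμpos) ?_
  have := congrArg (fun v => μ⁻¹ • v) h
  simpa only [hw, smul_add, smul_smul, inv_mul_cancel₀ hμne, one_smul, smul_zero] using this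

/-- **`[g ∘ κ_c] = [g ∘ κ_h]` in `π_N(X, x₀)` in every dimension `N ≥ 2`**: the collapse device of
`HomotopyAdditionProofs.lean` and the radial device of `HurewiczSimplexClass.lean` define the same
class of every singular simplex `g : (Δᴺ, ∂Δᴺ) → (X, x₀)` — the comparison "up to a global sign"
announced in `RelativeHomotopyAddition.lean`, with sign `+1`. [folklore] -/
theorem collapseClass_eq_simplexClass_of_two_le {X : Type u} [TopologicalSpace X] {x₀ : X} (hN : 2 ≤ N)
    (g : C(StdSimplex N, X)) (hg : ∀ t ∈ stdBoundary N, g t = x₀) :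
    collapseClass g hg = simplexClass g hg :=
  collapseClass_eq_simplexClass (nonAntipodal_of_two_le hN) g hg

end AllDims

end Literature.AlgebraicTopology.SingularHomology

end
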